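import Literature.Barriers.CriticalPhenomena.RigorousRGSmallParameterLocRange
import Literature.Barriers.CriticalPhenomena.RigorousRGSmallParameterPerturbativeFunctionals
import Literature.Barriers.CriticalPhenomena.RigorousRGSmallParameterTphiHeatAlgebra
import HarnessLib

/-!
# `RigorousRGSmallParameter` (Slade, Theorem 1.4.1): covariance of `Δ_C`, `e^{tΔ_C}` and `F_C`
# under the symmetries of the model, and locality from coefficient support

Companion ("proof architecture") file of
`Literature/Barriers/CriticalPhenomena/RigorousRGSmallParameter.lean`. To apply Slade's range
statement for `Loc_x` (`…LocRange`: `Loc_x F ∈ 𝒰` for symmetric local `F`) to the functionals of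
§4.3 (`W_j`, `P_j`, `φ_pt`, file `…PerturbativeFunctionals`) one needs that `ℒ_C = ½Δ_C`,
`e^{±ℒ_C}` and `F_C` commute with the two symmetries of the model — the `O(n)` action on the
components (§1.2) and the lattice automorphisms (Euclidean invariance of the covariance
decomposition, §3.1) — and that functionals with coefficients supported near `x` are local. This
file proves:

* the chain rule for the Laplacian under a linear field map `T` with coordinate matrix `c`:
  **`Δ_Ĉ(F ∘ T) = (Δ_{cĈcᵀ}F) ∘ T`** (`lapC_comp_clm`, `conjC`), hence invariance of `Δ_Ĉ`, its
  powers and `e^{tΔ_Ĉ}` whenever `cĈcᵀ = Ĉ`;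
* `cĈcᵀ = Ĉ` for `T = T_R`, `R` orthogonal (`conjC_compMap_of_isOrth`, using `RᵀR = 1 ⇒ RRᵀ = 1`),
  and for `T = T_Θ` an automorphism fixing `a` with `C_{Θ_au,Θ_av} = C_{uv}` (`conjC_fieldMap`);
  consequences `expL_comp_compMap`, `expL_comp_fieldMap`, **`FC_comp_clm`**;
* **locality from coefficients**: a smooth `F` whose first-order coefficients `F_{[ξ]}` vanish for
  labels `ξ` outside `S` lies in `𝒩(S)` (`dependsOn_of_coeff_eq_zero`, by constancy along the
  segment `ψ + t(φ-ψ)`), and the equivalence of `𝒩(S)` with coefficient support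
  (`dependsOn_of_coeffSupp`, `coeffSupp_of_dependsOn`).

Sources: G. Slade, arXiv:1611.06169, §1.2, §3.1, §4.3; D. C. Brydges, G. Slade [BS-rg-loc]
arXiv:1403.7253 §1.5 (symmetries commuting with the operations of the RG map).

## What this file provides (definitions with proved properties; no named fact)

* `conjC`, **`lapC_comp_clm`**, `lapPow_comp_clm`, `expLap_comp_clm`.
* `conjC_compMap`, `isOrth_row`, **`conjC_compMap_of_isOrth`**, `conjC_of_isLabelPerm`,
  **`conjC_fieldMap`**, `expL_comp_compMap`, `expL_comp_fieldMap`, **`FC_comp_clm`**.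
* `fderiv_apply_eq_sum`, **`dependsOn_of_coeff_eq_zero`**, `dependsOn_of_coeffSupp`,
  `coeffSupp_of_dependsOn`.

## References

* [Slade2017] G. Slade, *Critical exponents for long-range O(n) models below the upper critical
  dimension*, Commun. Math. Phys. 358 (2018) 343–436, arXiv:1611.06169 — §1.2, §3.1, §4.3.
* [BrydgesSlade2015RGII] D. C. Brydges, G. Slade, *A renormalisation group method. II.*,
  J. Stat. Phys. 159 (2015) 461–491, arXiv:1403.7253 — §1.5.
-/

noncomputable section

namespace Literature.Barriers.CriticalPhenomena

namespace LongRangePhi4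

namespace PTFun

open Finset Tphi RGNorm LocalPoly Loc Polymer Literature.Probability.LatticeModels
open scoped ContDiff

variable {d M n : ℕ} [NeZero M]

/-! ### `Δ_C(F ∘ T) = (Δ_{cCcᵀ}F) ∘ T` -/

/-- The conjugated covariance `(cĈcᵀ)_{w₁w₂} = Σ_{p,q} c_{w₁p} Ĉ_{pq} c_{w₂q}` of a linear field map
`T` with coordinate matrix `c`. [folklore] -/
def conjC (T : (TorusSite d M → Fin n → ℝ) →L[ℝ] (TorusSite d M → Fin n → ℝ))
    (Ch : TorusSite d M × Fin n → TorusSite d M × Fin n → ℝ) : TorusSite d M × Fin n → TorusSite d M × Fin n → ℝ :=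
  fun w₁ w₂ => ∑ p, ∑ q, clmCoord T w₁ p * Ch p q * clmCoord T w₂ q

/-- **`Δ_Ĉ(F ∘ T) = (Δ_{cĈcᵀ}F) ∘ T`** (chain rule for the Laplacian). [folklore] -/
theorem lapC_comp_clm (T : (TorusSite d M → Fin n → ℝ) →L[ℝ] (TorusSite d M → Fin n → ℝ))
    (Ch : TorusSite d M × Fin n → TorusSite d M × Fin n → ℝ) {F : (TorusSite d M → Fin n → ℝ) → ℝ} (hF : ContDiff ℝ ∞ F) :
    lapC (basisDir d M n) Ch (fun φ => F (T φ)) = fun φ => lapC (basisDir d M n) (conjC T Ch) F (T φ) := by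
  funext φ
  simp only [lapC, conjC]
  -- expand the coefficients of `F ∘ T`
  have h : ∀ p q, coeff (basisDir d M n) [p, q] (fun ψ => F (T ψ)) φ =
      ∑ w₁, ∑ w₂, clmCoord T w₁ p * clmCoord T w₂ q * coeff (basisDir d M n) [w₁, w₂] F (T φ) := by
    intro p q
    rw [coeff_comp_clm T hF [p, q] φ]
    simp only [List.length_cons, List.length_nil, sumSeq_succ, sumSeq_zero, List.zipWith_cons_cons,
      List.zipWith_nil_right, List.prod_cons, List.prod_nil, mul_one]
  simp only [h, Finset.mul_sum, Finset.sum_mul]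
  set G : TorusSite d M × Fin n → TorusSite d M × Fin n → TorusSite d M × Fin n → TorusSite d M × Fin n → ℝ :=
    fun p q w₁ w₂ => Ch p q * (clmCoord T w₁ p * clmCoord T w₂ q * coeff (basisDir d M n) [w₁, w₂] F (T φ)) with hG
  have hre : ∑ p, ∑ q, ∑ w₁, ∑ w₂, G p q w₁ w₂ = ∑ w₁, ∑ w₂, ∑ p, ∑ q, G p q w₁ w₂ := by
    calc ∑ p, ∑ q, ∑ w₁, ∑ w₂, G p q w₁ w₂ = ∑ p, ∑ w₁, ∑ q, ∑ w₂, G p q w₁ w₂ :=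
          Finset.sum_congr rfl fun p _ => Finset.sum_comm
      _ = ∑ w₁, ∑ p, ∑ q, ∑ w₂, G p q w₁ w₂ := Finset.sum_comm
      _ = ∑ w₁, ∑ p, ∑ w₂, ∑ q, G p q w₁ w₂ :=
          Finset.sum_congr rfl fun w₁ _ => Finset.sum_congr rfl fun p _ => Finset.sum_comm
      _ = ∑ w₁, ∑ w₂, ∑ p, ∑ q, G p q w₁ w₂ := Finset.sum_congr rfl fun w₁ _ => Finset.sum_comm
  rw [hre]
  refine Finset.sum_congr rfl fun w₁ _ => Finset.sum_congr rfl fun w₂ _ => Finset.sum_congr rfl fun p _ =>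
    Finset.sum_congr rfl fun q _ => ?_
  rw [hG]
  ring

/-- **Invariance**: if `cĈcᵀ = Ĉ` then `Δ_Ĉ(F ∘ T) = (Δ_ĈF) ∘ T`, and the same for the powers and for
`e^{tΔ_Ĉ}`. [folklore] -/
theorem lapPow_comp_clm {T : (TorusSite d M → Fin n → ℝ) →L[ℝ] (TorusSite d M → Fin n → ℝ)}
    {Ch : TorusSite d M × Fin n → TorusSite d M × Fin n → ℝ} (hT : conjC T Ch = Ch)
    {F : (TorusSite d M → Fin n → ℝ) → ℝ} (hF : ContDiff ℝ ∞ F) :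
    ∀ k, lapPow (basisDir d M n) Ch k (fun φ => F (T φ)) = fun φ => lapPow (basisDir d M n) Ch k F (T φ)
  | 0 => rfl
  | k + 1 => by
      rw [lapPow_succ, lapPow_comp_clm hT hF k, lapC_comp_clm T Ch (contDiff_lapPow _ Ch hF k), hT, lapPow_succ]

/-- `e^{tΔ_Ĉ}(F ∘ T) = (e^{tΔ_Ĉ}F) ∘ T` when `cĈcᵀ = Ĉ`. [folklore] -/
theorem expLap_comp_clm {T : (TorusSite d M → Fin n → ℝ) →L[ℝ] (TorusSite d M → Fin n → ℝ)}
    {Ch : TorusSite d M × Fin n → TorusSite d M × Fin n → ℝ} (hT : conjC T Ch = Ch) (A : ℕ) (t : ℝ)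
    {F : (TorusSite d M → Fin n → ℝ) → ℝ} (hF : ContDiff ℝ ∞ F) :
    expLap (basisDir d M n) Ch A t (fun φ => F (T φ)) = fun φ => expLap (basisDir d M n) Ch A t F (T φ) := by
  funext φ
  simp only [expLap]
  exact Finset.sum_congr rfl fun k _ => by rw [congrFun (lapPow_comp_clm hT hF k) φ]

/-! ### The two symmetries of the model: `O(n)` and the lattice automorphisms fixing a point -/

/-- For `T = T_R`: `cĈcᵀ = (RRᵀ) ⊗ C`; hence `= Ĉ` for orthogonal `R`. [folklore] -/
theorem conjC_compMap (R : Fin n → Fin n → ℝ) (C : TorusSite d M → TorusSite d M → ℝ) (w₁ w₂ : TorusSite d M × Fin n) :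
    conjC (compMap R) (lapCov C) w₁ w₂ = (∑ i, R w₁.2 i * R w₂.2 i) * C w₁.1 w₂.1 := by
  unfold conjC
  simp only [clmCoord_compMap, lapCov, Fintype.sum_prod_type]
  rw [Finset.sum_eq_single w₁.1]
  · rw [Finset.sum_mul]
    refine Finset.sum_congr rfl fun i _ => ?_
    rw [Finset.sum_eq_single w₂.1]
    · rw [Finset.sum_eq_single i]
      · simp only [if_true]; ring
      · intro j _ hj; simp [Ne.symm hj]
      · intro h; exact absurd (Finset.mem_univ _) h
    · intro y _ hy; exact Finset.sum_eq_zero fun j _ => by simp [Ne.symm hy]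
    · intro h; exact absurd (Finset.mem_univ _) h
  · intro y _ hy; exact Finset.sum_eq_zero fun j _ => Finset.sum_eq_zero fun y' _ => Finset.sum_eq_zero fun j' _ => by
      simp [Ne.symm hy]
  · intro h; exact absurd (Finset.mem_univ _) h

/-- Column-orthogonality implies row-orthogonality (`RᵀR = 1 ⇒ RRᵀ = 1`). [folklore] -/
theorem isOrth_row {R : Fin n → Fin n → ℝ} (hR : IsOrth R) (i j : Fin n) : ∑ k, R i k * R j k = if i = j then 1 else 0 := by
  have h1 : (Matrix.of fun i j => R i j).transpose * (Matrix.of fun i j => R i j) = 1 := by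
    ext a b
    rw [Matrix.mul_apply, Matrix.one_apply]
    simp only [Matrix.transpose_apply, Matrix.of_apply]
    exact hR a b
  have h2 := mul_eq_one_comm.1 h1
  have h3 := congrFun (congrFun h2 i) j
  rw [Matrix.mul_apply, Matrix.one_apply] at h3
  simpa [Matrix.transpose_apply, Matrix.of_apply] using h3

/-- **`O(n)` invariance of `Δ_C`**: `cĈcᵀ = Ĉ` for `T = T_R`, `R` orthogonal. [cite: Slade2017, §1.2 (O(n) invariance)] -/
theorem conjC_compMap_of_isOrth {R : Fin n → Fin n → ℝ} (hR : IsOrth R) (C : TorusSite d M → TorusSite d M → ℝ) :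
    conjC (compMap R) (lapCov (n := n) C) = lapCov C := by
  funext w₁ w₂
  rw [conjC_compMap, isOrth_row hR, lapCov]
  by_cases h : w₁.2 = w₂.2 <;> simp [h]

/-- For a label permutation `π`: `(cĈcᵀ)_{w₁w₂} = Ĉ_{π⁻¹w₁, π⁻¹w₂}`. [folklore] -/
theorem conjC_of_isLabelPerm {T : (TorusSite d M → Fin n → ℝ) →L[ℝ] (TorusSite d M → Fin n → ℝ)}
    {π : TorusSite d M × Fin n ≃ TorusSite d M × Fin n} (hT : IsLabelPerm T π)
    (Ch : TorusSite d M × Fin n → TorusSite d M × Fin n → ℝ) (w₁ w₂ : TorusSite d M × Fin n) :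
    conjC T Ch w₁ w₂ = Ch (π.symm w₁) (π.symm w₂) := by
  unfold conjC
  simp only [clmCoord_of_isLabelPerm hT]
  rw [Finset.sum_eq_single (π.symm w₁)]
  · rw [Finset.sum_eq_single (π.symm w₂)]
    · simp
    · intro q _ hq
      have : w₂ ≠ π q := fun h => hq (by rw [h, Equiv.symm_apply_apply])
      simp [this]
    · intro h; exact absurd (Finset.mem_univ _) h
  · intro p _ hp
    have : w₁ ≠ π p := fun h => hp (by rw [h, Equiv.symm_apply_apply])
    exact Finset.sum_eq_zero fun q _ => by simp [this]
  · intro h; exact absurd (Finset.mem_univ _) h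

/-- **Euclidean invariance of `Δ_C`**: `cĈcᵀ = Ĉ` for `T = T_Θ` (an automorphism fixing `a`) when
`C_{Θ_a u, Θ_a v} = C_{uv}`. [cite: Slade2017, §3.1 (Euclidean invariance of the covariance decomposition)] -/
theorem conjC_fieldMap (Θ : AxisSym d) (a : TorusSite d M) {C : TorusSite d M → TorusSite d M → ℝ}
    (hC : ∀ u v, C (Θ.pt a u) (Θ.pt a v) = C u v) : conjC (Θ.fieldMap a) (lapCov (n := n) C) = lapCov C := by
  funext w₁ w₂
  rw [conjC_of_isLabelPerm (Θ.isLabelPerm_fieldMap a)]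
  simp only [lapCov, AxisSym.labelPerm, Equiv.prodCongr_symm, Equiv.refl_symm, Equiv.prodCongr_apply, Prod.map_fst,
    Prod.map_snd, Equiv.refl_apply, Equiv.symm_symm]
  by_cases h : w₁.2 = w₂.2
  · rw [if_pos h, if_pos h]; exact hC w₁.1 w₂.1
  · rw [if_neg h, if_neg h]

/-! ### Consequences for `e^{tΔ_C}`, `F_C` -/

/-- **`e^{tΔ_C}` commutes with `T_R`, `R ∈ O(n)`.** [folklore] -/
theorem expL_comp_compMap {R : Fin n → Fin n → ℝ} (hR : IsOrth R) (C : TorusSite d M → TorusSite d M → ℝ) (A : ℕ) (t : ℝ)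
    {F : (TorusSite d M → Fin n → ℝ) → ℝ} (hF : ContDiff ℝ ∞ F) :
    expL C A t (fun φ => F (compMap R φ)) = fun φ => expL C A t F (compMap R φ) :=
  expLap_comp_clm (conjC_compMap_of_isOrth hR C) A t hF

/-- **`e^{tΔ_C}` commutes with `T_Θ` for a `Θ`-invariant `C`.** [folklore] -/
theorem expL_comp_fieldMap (Θ : AxisSym d) (a : TorusSite d M) {C : TorusSite d M → TorusSite d M → ℝ}
    (hC : ∀ u v, C (Θ.pt a u) (Θ.pt a v) = C u v) (A : ℕ) (t : ℝ)
    {F : (TorusSite d M → Fin n → ℝ) → ℝ} (hF : ContDiff ℝ ∞ F) :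
    expL C A t (fun φ => F (Θ.fieldMap a φ)) = fun φ => expL (n := n) C A t F (Θ.fieldMap a φ) :=
  expLap_comp_clm (conjC_fieldMap Θ a hC) A t hF

/-- **`F_C` commutes with any linear `T` under which `Δ_C` is invariant**:
`F_C(P ∘ T, Q ∘ T) = F_C(P,Q) ∘ T`. [folklore] -/
theorem FC_comp_clm {T : (TorusSite d M → Fin n → ℝ) →L[ℝ] (TorusSite d M → Fin n → ℝ)}
    {C : TorusSite d M → TorusSite d M → ℝ} (hT : conjC T (lapCov (n := n) C) = lapCov C) (A : ℕ)
    {P Q : (TorusSite d M → Fin n → ℝ) → ℝ} (hP : ContDiff ℝ ∞ P) (hQ : ContDiff ℝ ∞ Q) :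
    FC C A (fun φ => P (T φ)) (fun φ => Q (T φ)) = fun φ => FC C A P Q (T φ) := by
  unfold FC expL
  rw [expLap_comp_clm hT A (-2⁻¹) hP, expLap_comp_clm hT A (-2⁻¹) hQ]
  have h := expLap_comp_clm hT A 2⁻¹ ((contDiff_expL C A (-2⁻¹) hP).mul (contDiff_expL C A (-2⁻¹) hQ))
  unfold expL at h
  funext φ
  rw [congrFun h φ]

/-! ### Locality from the coefficients: `F_ξ ≡ 0` off `S` implies `F ∈ 𝒩(S)` -/

/-- The Fréchet derivative in the coordinate directions: `DF(θ)v = Σ_ξ v_ξ F_{[ξ]}(θ)`. [folklore] -/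
theorem fderiv_apply_eq_sum {F : (TorusSite d M → Fin n → ℝ) → ℝ} (θ v : TorusSite d M → Fin n → ℝ) :
    fderiv ℝ F θ v = ∑ ξ : TorusSite d M × Fin n, v ξ.1 ξ.2 * coeff (basisDir d M n) [ξ] F θ := by
  conv_lhs => rw [← sum_fieldFn_smul_basisDir v]
  rw [map_sum]
  refine Finset.sum_congr rfl fun ξ _ => ?_
  rw [map_smul, smul_eq_mul, coeff_cons, coeff_nil]
  rfl

/-- **Coefficient support implies locality**: if `F` is smooth and `F_{[ξ]} ≡ 0` for every label
`ξ` outside `S`, then `F ∈ 𝒩(S)` (its values depend on `φ|_S` only). [folklore] -/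
theorem dependsOn_of_coeff_eq_zero {S : Finset (TorusSite d M)} {F : (TorusSite d M → Fin n → ℝ) → ℝ}
    (hF : ContDiff ℝ ∞ F) (h : ∀ ξ : TorusSite d M × Fin n, ξ.1 ∉ S → coeff (basisDir d M n) [ξ] F = fun _ => 0) :
    DependsOn S F := by
  intro φ ψ hφψ
  -- the function `g(t) = F(ψ + t(φ - ψ))` has zero derivative
  set v : TorusSite d M → Fin n → ℝ := φ - ψ with hv
  have hvS : ∀ ξ : TorusSite d M × Fin n, ξ.1 ∈ S → v ξ.1 ξ.2 = 0 := by
    intro ξ hξ; simp [hv, hφψ ξ.1 hξ]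
  set g : ℝ → ℝ := fun t => F (ψ + t • v) with hg
  have hdiff : Differentiable ℝ F := hF.differentiable (by simp)
  have hline : ∀ t, HasDerivAt (fun t : ℝ => ψ + t • v) v t := by
    intro t
    have := ((hasDerivAt_id t).smul_const v).const_add ψ
    simpa using this
  have hg' : ∀ t, HasDerivAt g 0 t := by
    intro t
    have h1 : HasDerivAt g (fderiv ℝ F (ψ + t • v) v) t :=
      (hdiff (ψ + t • v)).hasFDerivAt.comp_hasDerivAt t (hline t)
    have h0 : fderiv ℝ F (ψ + t • v) v = 0 := by
      rw [fderiv_apply_eq_sum]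
      refine Finset.sum_eq_zero fun ξ _ => ?_
      by_cases hξ : ξ.1 ∈ S
      · rw [hvS ξ hξ, zero_mul]
      · rw [congrFun (h ξ hξ) _, mul_zero]
    rwa [h0] at h1
  have hconst := is_const_of_deriv_eq_zero (f := g) (fun t => (hg' t).differentiableAt) (fun t => (hg' t).deriv) 1 0
  simp only [hg, one_smul, zero_smul, add_zero] at hconst
  rw [← hconst, hv]
  congr 1
  abel

/-- In particular coefficient support in `S × [n]` gives `F ∈ 𝒩(S)`. [folklore] -/
theorem dependsOn_of_coeffSupp {S : Finset (TorusSite d M)} {F : (TorusSite d M → Fin n → ℝ) → ℝ}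
    (hF : ContDiff ℝ ∞ F) (h : CoeffSupp (basisDir d M n) (S ×ˢ (Finset.univ : Finset (Fin n))) F) : DependsOn S F :=
  dependsOn_of_coeff_eq_zero hF fun ξ hξ => funext fun θ => h [ξ] θ ⟨ξ, by simp, by simp [hξ]⟩

/-- Conversely `F ∈ 𝒩(S)` has coefficient support in `S × [n]`. [folklore] -/
theorem coeffSupp_of_dependsOn {S : Finset (TorusSite d M)} {F : (TorusSite d M → Fin n → ℝ) → ℝ}
    (hF : ContDiff ℝ ∞ F) (h : DependsOn S F) : CoeffSupp (basisDir d M n) (S ×ˢ (Finset.univ : Finset (Fin n))) F := by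
  intro z θ hz
  obtain ⟨a, ha, haS⟩ := hz
  have haS' : a.1 ∉ S := by simpa using haS
  rw [congrFun (coeff_eq_zero_of_dependsOn h hF ⟨a, ha, haS'⟩) θ]

end PTFun

end LongRangePhi4

end Literature.Barriers.CriticalPhenomena

end
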